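import Mathlib
import Summits.ValiantsHypothesis.ValiantsHypothesis.Theses.OneNatPerBit
import Summits.ValiantsHypothesis.ValiantsHypothesis.Theses.FreeFermionCLL
import Summits.ValiantsHypothesis.ValiantsHypothesis.Theorems.FreeFermionCLLExpImpliesGap
import Summits.ValiantsHypothesis.ValiantsHypothesis.Theorems.FreeFermionCLLQpArith
import Literature.Computability.AlgebraicComplexity.PermanentCorrelation
import Literature.Computability.AlgebraicComplexity.DeterminantalComplexity
import Literature.Computability.AlgebraicComplexity.VPDeterminantalQPProofs

/-!
# Line `vsbr-pm-seam` for crux `CorrelationGap` (route OneNatPerBit, item stmt-ValiantsHypothesis-10315)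

Crux-strategist line = the BC2-redirect DECOMPOSITION of the restated deciding crux written as a
checked skeleton (the route-level `--split` is gate-deferred to the seat's final cycle):

    stub_qpDetRepr → stub_pmNormalForm → FreeFermionCLL.ExpRankLaw → CorrelationGap.

* `stub_qpDetRepr` (THEOREM, M–L): Valiant–Skyum–Berkowitz–Rackoff / BCS 1997 (21.36)+(21.27) for the
  degree-`n` component of a poly-size circuit output — `dc([deg n] P.eval) ≤ 2^((log₂ n + C)^C)`;
  every ingredient is in `VPDeterminantalQPProofs.lean` (`exists_slp`, `SLP.homogenize`,
  `hasInvRepr_aval`, `invReprBound_two_pow_le`, `HasInvRepr.hasDetRepr`).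
* `stub_pmNormalForm` (THEOREM, M–L): a homogeneous `g` of degree `n` with `HasDetRepr g m` is
  `s · [deg n] det(I_R + diag(x∘κ)K)` with `R ≤ n²·m` (shift to a non-root, Weinstein–Aronszajn
  `Matrix.det_one_add_mul_comm` as in `FreeFermionCLLTotalRankLeDc.det_one_add_sum_X_smul_map_C`,
  translation invariance of the top homogeneous component).
* the two stubs give the child piece `QpPrincipalMinorForm` (`qpPrincipalMinorForm_of`, with the
  landed `qpArith_proof`), and the shared OPEN crux `FreeFermionCLL.ExpRankLaw`
  (stmt-ValiantsHypothesis-13557, a by-name hypothesis of `CorrelationGap_of`, NOT a stub) closes the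
  crux through `correlationGap_of_pieces` (= `CorrelationGap_of_subs`: landed `expImpliesGap_proof`,
  `permMass` sees only the degree-`n` component, `coeffNormSq` only drops, both scale with `|s|²`).

Honest label: after the two stubs are proved the crux is `blocked-on: stmt-ValiantsHypothesis-13557`
(ExpRankLaw), which is far stronger than VP ≠ VNP (⇒ dc(per_n) ≥ 2^Ω(n)/n²); this line does not make
the open content easier, it RELOCATES it onto the one staffed law both correlation routes share.
-/

-- single-conjunct layout: Sub = Summit, duplicated namespace component intended
set_option linter.dupNamespace false

namespace Summit.ValiantsHypothesis.ValiantsHypothesis.Cruxes.CorrelationGap.VsbrPmSeam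

open MvPolynomial Literature.Computability.AlgebraicComplexity
open scoped Matrix BigOperators

/-- **Stub 1 (VSBR for the degree-`n` component).**  For every `c` there is `C` such that the
degree-`n` homogeneous component of the output of every fan-in-two circuit over `ℂ` in the `x_ij`
with `≤ n^c` gates has an affine determinantal representation of size `≤ 2^((log₂ n + C)^C)`
(Valiant–Skyum–Berkowitz–Rackoff 1983; BCS 1997 Thm. (21.36) with Thm. (21.27); the tree's
`VPDeterminantalQPProofs.lean` applied to node `(i, Q n)` of `SLP.homogenize n`). -/
theorem stub_qpDetRepr :
    ∀ c : ℕ, ∃ C n₀ : ℕ, ∀ n ≥ n₀,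
      ∀ P : Literature.Computability.AlgebraicComplexity.ArithCircuit ℂ (Fin n × Fin n),
        P.IsFanInTwo → P.size ≤ n ^ c →
          ∃ m ≤ 2 ^ ((Nat.log 2 n + C) ^ C), HasDetRepr (homogeneousComponent n P.eval) m := by
  sorry

/-- **Stub 2 (principal-minor normal form of a homogeneous polynomial).**  A homogeneous `g` of
degree `n` in the `n²` variables `x_ij` with an affine determinantal representation of size `m` is
`s · [deg n] det(I_R + diag(x∘κ)·K)` for some principal-minor form of total rank `R ≤ n²·m`
(shift to a non-root, Weinstein–Aronszajn/Sylvester, translation invariance of the top component;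
Ikenmeyer–Landsberg 2017 Def. 2.8; in tree for `per_n`: `FreeFermionCLLTotalRankLeDc`). -/
theorem stub_pmNormalForm :
    ∀ (n m : ℕ) (g : MvPolynomial (Fin n × Fin n) ℂ), g.IsHomogeneous n → HasDetRepr g m →
      ∃ R ≤ n ^ 2 * m, ∃ (K : Matrix (Fin R) (Fin R) ℂ) (κ : Fin R → Fin n × Fin n) (s : ℂ),
        g = MvPolynomial.C s * MvPolynomial.homogeneousComponent n
          (1 + Matrix.diagonal (fun i => MvPolynomial.X (κ i)) *
            K.map (fun a : ℂ => (MvPolynomial.C a : MvPolynomial (Fin n × Fin n) ℂ))).det := by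
  sorry

/-- A permutation monomial `∏_i X_{(ρ i, i)}` has degree `n` (one variable in each row,
`rowCount_permMonomial`). [folklore] -/
theorem degree_permMonomial {n : ℕ} (ρ : Equiv.Perm (Fin n)) : (permMonomial ρ).degree = n := by
  rw [Finsupp.degree_eq_sum, Fintype.sum_prod_type]
  have h : ∀ r : Fin n, ∑ c, permMonomial ρ (r, c) = 1 := fun r => rowCount_permMonomial ρ r
  simp_rw [h]
  simp

/-- The permutation mass only sees the degree-`n` homogeneous component:
`permMass n f^(n) = permMass n f`. [folklore] -/
theorem permMass_homogeneousComponent {n : ℕ} (f : MvPolynomial (Fin n × Fin n) ℂ) :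
    permMass n (homogeneousComponent n f) = permMass n f := by
  rw [permMass_def, permMass_def]
  refine Finset.sum_congr rfl fun σ _ => ?_
  rw [coeff_homogeneousComponent, if_pos (degree_permMonomial σ)]

/-- Passing to the degree-`n` component only removes monomials:
`coeffNormSq n f^(n) ≤ coeffNormSq n f`. [folklore] -/
theorem coeffNormSq_homogeneousComponent_le {n : ℕ} (f : MvPolynomial (Fin n × Fin n) ℂ) :
    coeffNormSq n (homogeneousComponent n f) ≤ coeffNormSq n f := by
  rw [coeffNormSq_def, coeffNormSq_def]
  have hcoeff : ∀ m ∈ (homogeneousComponent n f).support,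
      coeff m (homogeneousComponent n f) = coeff m f := by
    intro m hm
    rw [mem_support_iff, coeff_homogeneousComponent] at hm
    rw [coeff_homogeneousComponent]
    by_cases h : m.degree = n
    · rw [if_pos h]
    · rw [if_neg h] at hm
      exact absurd rfl hm
  have hsub : (homogeneousComponent n f).support ⊆ f.support := by
    intro m hm
    have hc := hcoeff m hm
    rw [mem_support_iff] at hm ⊢
    rwa [hc] at hm
  calc ∑ m ∈ (homogeneousComponent n f).support, ‖coeff m (homogeneousComponent n f)‖ ^ 2
        = ∑ m ∈ (homogeneousComponent n f).support, ‖coeff m f‖ ^ 2 :=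
          Finset.sum_congr rfl fun m hm => by rw [hcoeff m hm]
    _ ≤ ∑ m ∈ f.support, ‖coeff m f‖ ^ 2 :=
          Finset.sum_le_sum_of_subset_of_nonneg hsub fun m _ _ => sq_nonneg _

/-- `coeffNormSq n (C s * f) = ‖s‖² · coeffNormSq n f`. [folklore] -/
theorem coeffNormSq_C_mul {n : ℕ} (s : ℂ) (f : MvPolynomial (Fin n × Fin n) ℂ) :
    coeffNormSq n (C s * f) = ‖s‖ ^ 2 * coeffNormSq n f := by
  rw [C_mul', coeffNormSq_smul]

/-- The route-level assembly `QpPrincipalMinorForm → ExpRankLaw → CorrelationGap` (verbatim copy of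
`CorrelationGap_of_subs` from `Cruxes/CorrelationGap/CorrelationGapOfSubs.lean`, kept here so that the
line is self-contained). -/
theorem correlationGap_of_pieces
    (h₁ : ∀ c : ℕ, ∃ C n₀ : ℕ, ∀ n ≥ n₀,
      ∀ P : Literature.Computability.AlgebraicComplexity.ArithCircuit ℂ (Fin n × Fin n),
        P.IsFanInTwo → P.size ≤ n ^ c →
          ∃ R ≤ 2 ^ ((Nat.log 2 n + C) ^ C), ∃ (K : Matrix (Fin R) (Fin R) ℂ)
            (κ : Fin R → Fin n × Fin n) (s : ℂ),
              MvPolynomial.homogeneousComponent n P.eval =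
                MvPolynomial.C s * MvPolynomial.homogeneousComponent n
                  (1 + Matrix.diagonal (fun i => MvPolynomial.X (κ i)) *
                    K.map (fun a : ℂ => (MvPolynomial.C a : MvPolynomial (Fin n × Fin n) ℂ))).det)
    (h₂ : Summit.ValiantsHypothesis.ValiantsHypothesis.Theses.FreeFermionCLL.ExpRankLaw) :
    -- the BODY of `OneNatPerBit.CorrelationGap` (spelled out so that exactly one theorem of this
    -- file, `CorrelationGap_of`, concludes the crux by name)
    ∀ c : ℕ, ∃ n₀ : ℕ, ∀ n ≥ n₀,
      ∀ P : Literature.Computability.AlgebraicComplexity.ArithCircuit ℂ (Fin n × Fin n),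
        P.IsFanInTwo → P.size ≤ n ^ c →
          2 * ‖∑ σ : Equiv.Perm (Fin n), MvPolynomial.coeff
              (Literature.Computability.AlgebraicComplexity.permMonomial σ) P.eval‖ ^ 2 ≤
            (n.factorial : ℝ) * P.eval.support.sum (fun m => ‖MvPolynomial.coeff m P.eval‖ ^ 2) := by
  -- exponential decay beats quasi-polynomial total rank (landed support of FreeFermionCLL)
  have hGap : Theses.FreeFermionCLL.PMCorrelationGap :=
    Summit.ValiantsHypothesis.ValiantsHypothesis.Theorems.FreeFermionCLL.expImpliesGap_proof h₂
  intro c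
  obtain ⟨C, n₁, hred⟩ := h₁ c
  obtain ⟨n₂, hgap⟩ := hGap C
  refine ⟨max n₁ n₂, fun n hn P hfan hsize => ?_⟩
  obtain ⟨R, hR, K, κ, s, hEq⟩ := hred n ((le_max_left _ _).trans hn) P hfan hsize
  have hineq := hgap n ((le_max_right _ _).trans hn) R hR K κ
  -- the principal-minor component delivered by the normal form
  set H : MvPolynomial (Fin n × Fin n) ℂ := MvPolynomial.homogeneousComponent n
    (1 + Matrix.diagonal (fun i => MvPolynomial.X (κ i)) *
      K.map (fun a : ℂ => (MvPolynomial.C a : MvPolynomial (Fin n × Fin n) ℂ))).det with hH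
  -- the target, in the vocabulary of `PermanentCorrelation.lean` (definitional)
  change 2 * ‖permMass n P.eval‖ ^ 2 ≤ (n.factorial : ℝ) * coeffNormSq n P.eval
  -- numerator: only the degree-n component counts, and it is `s · permMass H`
  have hpm : permMass n P.eval = s * permMass n H := by
    rw [← permMass_homogeneousComponent P.eval, hEq, permMass_C_mul]
  -- denominator: dropping the other components only lowers it
  have hcn : (n.factorial : ℝ) * coeffNormSq n (MvPolynomial.C s * H) ≤
      (n.factorial : ℝ) * coeffNormSq n P.eval := by
    rw [← hEq]
    exact mul_le_mul_of_nonneg_left (coeffNormSq_homogeneousComponent_le _) (Nat.cast_nonneg _)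
  rw [hpm, norm_mul, mul_pow]
  calc 2 * (‖s‖ ^ 2 * ‖permMass n H‖ ^ 2) = ‖s‖ ^ 2 * (2 * ‖permMass n H‖ ^ 2) := by ring
    _ ≤ ‖s‖ ^ 2 * ((n.factorial : ℝ) * coeffNormSq n H) :=
        mul_le_mul_of_nonneg_left hineq (sq_nonneg _)
    _ = (n.factorial : ℝ) * coeffNormSq n (MvPolynomial.C s * H) := by rw [coeffNormSq_C_mul]; ring
    _ ≤ (n.factorial : ℝ) * coeffNormSq n P.eval := hcn


/-- The two stubs give the child piece `QpPrincipalMinorForm` (sorry-free; quasi-polynomial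
arithmetic by the landed `qpArith_proof`). -/
theorem qpPrincipalMinorForm_of
    (h₁ : ∀ c : ℕ, ∃ C n₀ : ℕ, ∀ n ≥ n₀,
      ∀ P : Literature.Computability.AlgebraicComplexity.ArithCircuit ℂ (Fin n × Fin n),
        P.IsFanInTwo → P.size ≤ n ^ c →
          ∃ m ≤ 2 ^ ((Nat.log 2 n + C) ^ C), HasDetRepr (homogeneousComponent n P.eval) m)
    (h₂ : ∀ (n m : ℕ) (g : MvPolynomial (Fin n × Fin n) ℂ), g.IsHomogeneous n → HasDetRepr g m →
      ∃ R ≤ n ^ 2 * m, ∃ (K : Matrix (Fin R) (Fin R) ℂ) (κ : Fin R → Fin n × Fin n) (s : ℂ),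
        g = MvPolynomial.C s * MvPolynomial.homogeneousComponent n
          (1 + Matrix.diagonal (fun i => MvPolynomial.X (κ i)) *
            K.map (fun a : ℂ => (MvPolynomial.C a : MvPolynomial (Fin n × Fin n) ℂ))).det) :
    ∀ c : ℕ, ∃ C n₀ : ℕ, ∀ n ≥ n₀,
      ∀ P : Literature.Computability.AlgebraicComplexity.ArithCircuit ℂ (Fin n × Fin n),
        P.IsFanInTwo → P.size ≤ n ^ c →
          ∃ R ≤ 2 ^ ((Nat.log 2 n + C) ^ C), ∃ (K : Matrix (Fin R) (Fin R) ℂ)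
            (κ : Fin R → Fin n × Fin n) (s : ℂ),
              MvPolynomial.homogeneousComponent n P.eval =
                MvPolynomial.C s * MvPolynomial.homogeneousComponent n
                  (1 + Matrix.diagonal (fun i => MvPolynomial.X (κ i)) *
                    K.map (fun a : ℂ => (MvPolynomial.C a : MvPolynomial (Fin n × Fin n) ℂ))).det := by
  intro c
  obtain ⟨C, n₀, hdc⟩ := h₁ c
  obtain ⟨C', hC'⟩ := Theorems.qpArith_proof C
  refine ⟨C', n₀, fun n hn P hfan hsize => ?_⟩
  obtain ⟨m, hm, hdet⟩ := hdc n hn P hfan hsize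
  obtain ⟨R, hR, K, κ, s, hg⟩ :=
    h₂ n m (homogeneousComponent n P.eval) (homogeneousComponent_isHomogeneous n P.eval) hdet
  exact ⟨R, hR.trans ((Nat.mul_le_mul_left _ hm).trans (hC' n)), K, κ, s, hg⟩

/-- **Composition of the line**: the two stubs (used directly, skeleton convention) and the shared
open crux `FreeFermionCLL.ExpRankLaw` (stmt-ValiantsHypothesis-13557, a registered obligation taken
BY NAME) give the crux `OneNatPerBit.CorrelationGap` BY NAME.  No `sorry` outside `stub_*`. -/
theorem CorrelationGap_of
    (hlaw : Summit.ValiantsHypothesis.ValiantsHypothesis.Theses.FreeFermionCLL.ExpRankLaw) :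
    Summit.ValiantsHypothesis.ValiantsHypothesis.Theses.OneNatPerBit.CorrelationGap :=
  correlationGap_of_pieces (qpPrincipalMinorForm_of stub_qpDetRepr stub_pmNormalForm) hlaw

end Summit.ValiantsHypothesis.ValiantsHypothesis.Cruxes.CorrelationGap.VsbrPmSeam
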